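import Summits.PneNP.PneNP.Theorems.SzkEntropyPeaWorstToAvgReductions
import Summits.PneNP.PneNP.Theorems.SzkEntropyPeaWorstToAvgDualModeCard
import Summits.PneNP.PneNP.Theorems.PeaWorstToAvg.Negative.PeaWorstToAvgStrengthenings
import Summits.PneNP.PneNP.Theorems.SzkEntropyPeaThreeNotInPKillSwitch
import Literature.Computability.Complexity.BranchingFn

/-!
# Drefute calibration for line `dual-mode-compile` (crux stmt-PneNP-10777 `SzkEntropy.PeaWorstToAvg`)

Author: refuter-drefute-stmt-PneNP-10777-0 (2026-08-16).  Evidence file (not a landing).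

§1 is a VERBATIM COPY of §1 (objects) and of three glue lemmas of §3 of the lead's skeleton
`Cruxes/PeaWorstToAvg/Lines/dual-mode-compile.lean` (as of 2026-08-16T02:04Z), placed in the namespace
`…Cruxes.PeaWorstToAvg.Drefute` (the skeleton is not an importable module; the lead's Defs file has not landed).

§2 CALIBRATION (sorry-free):
* `modeKit_of_mem_PromiseBPP'` : `PEA 3 ∈ PromiseBPP' → Nonempty ModeKit` — the kill switch builds a (degenerate)
  mode kit: constant certified samplers on the fixed NO / YES instances of `BPEA` and `enc :=` the amplified
  promise decider (error `≤ 1/16` on the promise) choosing between the two constants.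
* hence `not_modeEncodingStmt_imp_hyp` : `¬ ModeEncodingStmt → PEA 3 ∉ PromiseBPP'` and
  `not_modeEncodingStmt_imp_peaThreeNotInP` : refuting STUB 1 proves the route's thesis X (`PeaThreeNotInP`);
* `not_deciderStmt_imp` : `¬ DeciderStmt → Nonempty ModeKit ∧ PEA 3 ∉ PromiseBPP'` (so refuting STUB 4 also
  proves X).
So STUBS 1 and 4 admit NO unconditional refutation short of proving `PEA₃ ∉ prBPP'` (thesis-strength); the
drefute verdict for them can only be "survived" or "misstated", and no misstatement was found.
-/

noncomputable section

set_option linter.dupNamespace false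

namespace Summit.PneNP.PneNP.Cruxes.PeaWorstToAvg.Drefute

open Literature.Computability.Complexity Literature.Computability.MetaComplexity
open Literature.Computability.Cryptography (IsCompIndistinguishable IsPPT distAdvantage)
open Literature.InformationTheory.Entropy (mapEntropy)
open _root_.Computability
open Summit.PneNP.PneNP.Theorems

/-! ## §1 Objects of the line -/

/-- An AFFINE LABEL over `ℓ` input bits: a constant bit and a list of variable indices; its value at
`x ∈ F₂^ℓ` is `c + Σ_{i ∈ S} xᵢ` (repetitions cancel in pairs).  Ordinary branching-program labels
`1`, `xᵢ`, `¬xᵢ = 1 + xᵢ` are the cases `|S| ≤ 1`. [IshaiKushilevitz2002, §3] -/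
abbrev AffLabel (ℓ : ℕ) : Type := Bool × List (Fin ℓ)

namespace AffLabel

/-- Value of an affine label at an input. -/
def eval {ℓ : ℕ} (a : AffLabel ℓ) (x : Fin ℓ → ZMod 2) : ZMod 2 :=
  (if a.1 then 1 else 0) + (a.2.map x).sum

end AffLabel

/-- An AFFINE PARITY BRANCHING PROGRAM on `ℓ` input bits (sparse presentation): nodes `0, …, N` with
`N = P.length`, source `0`, sink `N`; row `i` lists the labels of the edges `i → i+1, i → i+2, …`
(missing entries: label `0`, i.e. no edge).  Its value is the number modulo `2` of source-to-sink paths,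
weighted by the product of the edge labels — every `⊕L` / deterministic-logspace keyed function has
polynomial-size such programs (one per output bit). [IshaiKushilevitz2002, §3; ApplebaumIshaiKushilevitz2006, §4] -/
abbrev AffBP (ℓ : ℕ) : Type := List (List (AffLabel ℓ))

namespace AffBP

variable {ℓ : ℕ}

/-- The label of the edge from node `i` to node `j + 1` (meaningful for `i ≤ j`; default `0`). -/
def label (P : AffBP ℓ) (i j : ℕ) : AffLabel ℓ :=
  (P.getD i []).getD (j - i) (false, [])

/-- **The Ishai–Kushilevitz matrix** `L(x)` of the program at input `x`: rows = nodes `0 … N-1`,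
columns = nodes `1 … N`; entry `(i, j)` = value of the label of the edge `i → j+1` for `i ≤ j`, `1` on the
subdiagonal (`i = j + 1`; `-1 = 1` over `F₂`), `0` below it.  [IshaiKushilevitz2002, §3 (the matrix `L(x)`)] -/
def mat (P : AffBP ℓ) (x : Fin ℓ → ZMod 2) : Matrix (Fin P.length) (Fin P.length) (ZMod 2) :=
  Matrix.of fun i j =>
    if i.val ≤ j.val then (P.label i.val j.val).eval x else if i.val = j.val + 1 then 1 else 0

/-- **Value of the program** at `x`: `det L(x)` = the weighted number of source-to-sink paths mod `2`
(expansion of the unit-lower-Hessenberg determinant). [IshaiKushilevitz2002, §3] -/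
def eval (P : AffBP ℓ) (x : Fin ℓ → ZMod 2) : ZMod 2 :=
  (P.mat x).det

end AffBP

/-- A multi-output affine parity branching program on `ℓ` input bits: one program per output bit. -/
abbrev AffBPMap (ℓ : ℕ) : Type := List (AffBP ℓ)

namespace AffBPMap

variable {ℓ : ℕ}

/-- The output word at `x`. -/
def eval (F : AffBPMap ℓ) (x : Fin ℓ → ZMod 2) : List (ZMod 2) :=
  F.map fun P => P.eval x

/-- **Output entropy** `H(F(U_ℓ))` in bits of the map on a uniform input (`mapEntropy`, as for
`PolyMapF2.entropy`). [DvirGutfreundRothblumVadhan2010, Def. 2.1] -/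
def entropy (F : AffBPMap ℓ) : ℝ :=
  mapEntropy Finset.univ F.eval

/-- Boolean encoding of multi-output affine programs on `ℓ` inputs (labels: bit paired with a list of
variable indices in binary; nested self-delimiting lists — the combinators of `PEAInst.encoding`). -/
def encoding (ℓ : ℕ) : Encoding (AffBPMap ℓ) Bool :=
  ((encodingBoolBool.pairBool (encodingFinBool ℓ).listBool).listBool.listBool).listBool

end AffBPMap

/-- Instances of `BPEA`: number of input bits `ℓ`, a multi-output affine parity branching program on
`ℓ` bits, an integer entropy threshold `k`. -/
abbrev BPEAInst : Type := Σ ℓ : ℕ, AffBPMap ℓ × ℕ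

/-- Boolean encoding of `BPEA` instances: `ℓ` in binary, then the program paired with `k` in binary. -/
def BPEAInst.encoding : Encoding BPEAInst Bool :=
  Encoding.sigmaBool fun ℓ => (AffBPMap.encoding ℓ).pairBool encodingNatBool

/-- **`BPEA` — Branching-Program Entropy Approximation** (gap `1` at integer thresholds, the convention of
`PEA`): on `(F, k)` with `F` a multi-output affine parity branching program, YES iff `H(F(U_ℓ)) ≥ k + 1`,
NO iff `H(F(U_ℓ)) ≤ k`.  This is Entropy Approximation [GoldreichSahaiVadhan1999] for `⊕`-branching-program
samplers — the format in which EVERY logspace keyed family (QR, DDH, DCR, LWE modes; Goldreich/DUE local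
functions; affine orbits of cubic maps) presents its two modes, and the SOURCE of the AIK compile `BPEA ≤ₚ PEA 3`
(`stub_compile`). [DvirGutfreundRothblumVadhan2010, Thm. 4.5–4.6; ApplebaumIshaiKushilevitz2006, §4] -/
def BPEA : PromiseProblem :=
  PromiseProblem.ofEncoding BPEAInst.encoding
    {I | (I.2.2 : ℝ) + 1 ≤ AffBPMap.entropy I.2.1}
    {I | AffBPMap.entropy I.2.1 ≤ (I.2.2 : ℝ)}

/-- `UHeurBPP`: randomized heuristic schemes (Bogdanov–Trevisan Def. 2.12–2.13, the tree's `HeurBPP`) whose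
coin budget is an honest polynomial of the input length — the UNIFORM sub-class (the tree's `RandAlg.coinLen`
is an arbitrary polynomially bounded function, i.e. `O(log)` advice; Disproof §5,
`Theorems/SzkEntropyPeaWorstToAvgAdviceLeak.lean`).  Verbatim the notion of `Lines/orbit-pair-rsr.lean`.
[BogdanovTrevisan2006, Def. 2.12–2.13; AroraBarak2009, §6.3] -/
def UHeurBPP : Set DistProblem :=
  {Q | ∃ A : RandAlg (List Bool × ℕ × ℕ) Bool, A.IsPolyTime schemeEnc encodeBool ∧
    (∃ c : Polynomial ℕ, ∀ ℓ, A.coinLen ℓ = c.eval ℓ) ∧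
    ∀ n m : ℕ, 0 < m →
      Q.dist.prob n {x | 1 / 4 ≤ A.pr schemeEnc (x, n, m) {b | b ≠ Q.lang.boolIndicator x}} ≤ 1 / m}

/-- **Mode kit** — the object asserted by the closing stub.  A CERTIFIED DUAL-MODE PAIR of branching-program
samplers plus a MODE-PRESERVING RANDOMIZED ENCODING of `PEA 3` onto it:
* `samp b` (`b = false/true`): UNIFORM polynomial-time samplers (honest polynomial coin budget `sampCoins`)
  whose output on `1ⁿ` is, for EVERY coin outcome and every `n`, a NO (resp. YES) instance of `BPEA`
  — the "lossy" and the "injective" mode, certified BY THE SAMPLER (syntactically / by trapdoor / by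
  construction), never by inspecting the instance;
* `enc`: ONE uniform polynomial-time randomized map on strings (coin budget `encCoins`) such that for every
  YES instance `x` of `PEA 3` the law of `enc x` is `1/16`-close, on every event, to the law of `samp true` on
  `1^{|x|}`, and for every NO instance to that of `samp false` (one-sided event bounds over all events =
  total variation `≤ 1/16`).
So `enc` is a statistical randomized encoding of the promise problem `PEA 3` whose two simulators are the
certified mode samplers; it need NOT preserve entropy and it NEED NOT land on the promise for every coin
(off-law outputs are charged to the `1/16`). [ApplebaumRaykov2016, Def. of `SRE`, Thm. 3;
PeikertWaters2008 (dual-mode families); FeigenbaumFortnow1993 (random self-reductions)] -/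
structure ModeKit where
  /-- certified sampler of mode `b` on input `1ⁿ` -/
  samp : Bool → RandAlg ℕ (List Bool)
  samp_polyTime : ∀ b, (samp b).IsPolyTime unaryEncodeNat (id : List Bool → List Bool)
  /-- its coin budget is this polynomial of the input length (uniformity) -/
  sampCoins : Polynomial ℕ
  samp_coinLen : ∀ b ℓ, (samp b).coinLen ℓ = sampCoins.eval ℓ
  samp_no : ∀ n, ∀ w ∈ ((samp false).outputPMF unaryEncodeNat n).support, w ∈ BPEA.no
  samp_yes : ∀ n, ∀ w ∈ ((samp true).outputPMF unaryEncodeNat n).support, w ∈ BPEA.yes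
  /-- the mode-preserving randomized encoder on instance strings -/
  enc : RandAlg (List Bool) (List Bool)
  enc_polyTime : enc.IsPolyTime (id : List Bool → List Bool) (id : List Bool → List Bool)
  encCoins : Polynomial ℕ
  enc_coinLen : ∀ ℓ, enc.coinLen ℓ = encCoins.eval ℓ
  enc_yes : ∀ x ∈ (PEA 3).yes, ∀ E : Set (List Bool),
    enc.pr id x E ≤ (samp true).pr unaryEncodeNat x.length E + 1 / 16
  enc_no : ∀ x ∈ (PEA 3).no, ∀ E : Set (List Bool),
    enc.pr id x E ≤ (samp false).pr unaryEncodeNat x.length E + 1 / 16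

namespace ModeKit

/-- The certified law of mode `b`: `n ↦` law of `samp b` on `1ⁿ`. -/
def law (kit : ModeKit) (b : Bool) : Ensemble := fun n => (kit.samp b).outputPMF unaryEncodeNat n

/-- The hard ensemble of the line: the fair mixture of the two certified laws. -/
def mix (kit : ModeKit) : Ensemble := mixEnsemble (kit.law false) (kit.law true)

end ModeKit

/-! ### The four statements of the line (readable names; the stubs of §2 state them verbatim) -/

/-- Statement of STUB 1: a mode kit exists. -/
abbrev ModeEncodingStmt : Prop := Nonempty ModeKit

/-- Statement of STUB 2: the AIK compile `BPEA ≤ₚ PEA 3` (from the canonical form). -/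
abbrev CompileStmt : Prop := BPEA.PolyTimeReducible (PEA 3)

/-- Statement of STUB 3: advice elimination for labelled certified mixtures. -/
abbrev AdviceElimStmt : Prop :=
  ∀ (Q : PromiseProblem), Q.Disjoint → ∀ (S : Bool → RandAlg ℕ (List Bool)),
    (∀ b, (S b).IsPolyTime unaryEncodeNat (id : List Bool → List Bool)) →
    ∀ c : Polynomial ℕ, (∀ b ℓ, (S b).coinLen ℓ = c.eval ℓ) →
    (∀ n, ∀ w ∈ ((S false).outputPMF unaryEncodeNat n).support, w ∈ Q.no) →
    (∀ n, ∀ w ∈ ((S true).outputPMF unaryEncodeNat n).support, w ∈ Q.yes) →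
    (⟨Q.yes, mixEnsemble (fun n => (S false).outputPMF unaryEncodeNat n)
        (fun n => (S true).outputPMF unaryEncodeNat n)⟩ : DistProblem) ∈ HeurBPP →
    (⟨Q.yes, mixEnsemble (fun n => (S false).outputPMF unaryEncodeNat n)
        (fun n => (S true).outputPMF unaryEncodeNat n)⟩ : DistProblem) ∈ UHeurBPP

/-- Statement of STUB 4: the encoded decider. -/
abbrev DeciderStmt : Prop :=
  ∀ kit : ModeKit, (⟨BPEA.yes, kit.mix⟩ : DistProblem) ∈ UHeurBPP → PEA 3 ∈ PromiseBPP'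

/-! ## §1b Glue copied from the skeleton (§3 there) -/

theorem BPEA_disjoint : BPEA.Disjoint := by
  refine PromiseProblem.disjoint_ofEncoding _ (Set.disjoint_left.2 fun I hY hN => ?_)
  simp only [Set.mem_setOf_eq] at hY hN
  linarith


/-- The empty program list on `0` inputs with threshold `0` is a NO instance of `BPEA` (`H = 0 ≤ 0`):
the NO side is inhabited at every parameter (cf. the BavardGap negative: support conditions must be
satisfiable at every `n`). -/
theorem exists_mem_BPEA_no : BPEAInst.encoding.encode ⟨0, ([], 0)⟩ ∈ BPEA.no := by
  refine (BPEAInst.encoding.mem_toLanguage_iff _ _).2 ?_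
  show AffBPMap.entropy ([] : AffBPMap 0) ≤ ((0 : ℕ) : ℝ)
  have h : AffBPMap.eval ([] : AffBPMap 0) = fun _ => [] := by
    funext x
    simp [AffBPMap.eval]
  rw [AffBPMap.entropy, h, Literature.InformationTheory.Entropy.mapEntropy_const]
  simp

/-- The one-edge program `x₀` on `1` input with threshold `0` is a YES instance of `BPEA` (`H = 1 ≥ 0 + 1`):
the YES side is inhabited too. -/
theorem exists_mem_BPEA_yes :
    BPEAInst.encoding.encode ⟨1, ([[[((false, [0]) : AffLabel 1)]]], 0)⟩ ∈ BPEA.yes := by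
  refine (BPEAInst.encoding.mem_toLanguage_iff _ _).2 ?_
  show ((0 : ℕ) : ℝ) + 1 ≤ AffBPMap.entropy ([[[((false, [0]) : AffLabel 1)]]] : AffBPMap 1)
  have hev : AffBPMap.eval ([[[((false, [0]) : AffLabel 1)]]] : AffBPMap 1) = fun x => [x 0] := by
    funext x
    simp [AffBPMap.eval, AffBP.eval, AffBP.mat, AffBP.label, AffLabel.eval, Matrix.det_unique]
  have hinj : Function.Injective (AffBPMap.eval ([[[((false, [0]) : AffLabel 1)]]] : AffBPMap 1)) := by
    rw [hev]
    intro x y hxy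
    funext i
    fin_cases i
    simpa using hxy
  have hH := Literature.InformationTheory.Entropy.mapEntropy_of_injective
    (Finset.univ : Finset (Fin 1 → ZMod 2)) hinj
  rw [AffBPMap.entropy, hH]
  simp

/-! ## §2 Calibration: the kill switch builds a mode kit -/

/-- Post-processing a Boolean verdict into one of two fixed strings is polynomial time (under the
output encoding `encodeBool` of the verdict): `iteFn id (const w₁) (const w₀)` on `[b]`. [folklore] -/
theorem polyTimeComputable_boolSelect (w₀ w₁ : List Bool) :
    PolyTimeComputable encodeBool (id : List Bool → List Bool)
      (fun b : Bool => if b then w₁ else w₀) := by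
  have hg : iteFn id (fun _ => w₁) (fun _ => w₀) ∈ FP :=
    iteFn_mem_FP (PolyTimeComputable.id id) (const_mem_FP w₁) (const_mem_FP w₀)
  refine PolyTimeComputable.of_encode_eq (f := iteFn id (fun _ => w₁) (fun _ => w₀)) encodeBool
    (fun _ => rfl) (fun b => ?_) hg
  change iteFn id (fun _ => w₁) (fun _ => w₀) [b] = if b then w₁ else w₀
  rw [iteFn_apply (show id [b] = [b] from rfl)]

/-- The encoder of the degenerate kit: run a promise decider `A` and output the fixed YES resp. NO
instance. -/
def selectEnc (A : RandAlg (List Bool) Bool) (w₀ w₁ : List Bool) : RandAlg (List Bool) (List Bool) where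
  run x r := if A.run x r then w₁ else w₀
  coinLen := A.coinLen

theorem selectEnc_isPolyTime {A : RandAlg (List Bool) Bool} (hA : A.IsPolyTime id encodeBool)
    (w₀ w₁ : List Bool) : (selectEnc A w₀ w₁).IsPolyTime (id : List Bool → List Bool) id :=
  ⟨PolyTimeComputable.comp_holds (polyTimeComputable_boolSelect w₀ w₁) hA.1, hA.2⟩

/-- The output law of `selectEnc` is the push-forward of `A`'s verdict law. -/
theorem selectEnc_outputPMF (A : RandAlg (List Bool) Bool) (w₀ w₁ : List Bool) (x : List Bool) :
    (selectEnc A w₀ w₁).outputPMF id x =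
      (A.outputPMF id x).map (fun b : Bool => if b then w₁ else w₀) := by
  simp only [RandAlg.outputPMF, selectEnc, PMF.map_comp]
  rfl

/-- Probabilities of a `RandAlg` are at most `1`. [folklore] -/
theorem randAlg_pr_le_one {α β : Type} (B : RandAlg α β) (ea : α → List Bool) (x : α) (E : Set β) :
    B.pr ea x E ≤ 1 := by
  unfold RandAlg.pr
  have h := PMF.toOuterMeasure_mono (B.outputPMF ea x) (Set.subset_univ (E ∩ (B.outputPMF ea x).support))
  rw [(PMF.toOuterMeasure_apply_eq_one_iff _ _).2 (Set.subset_univ _)] at h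
  simpa using ENNReal.toReal_mono ENNReal.one_ne_top h

/-- Probabilities of a `RandAlg` are nonnegative. [folklore] -/
theorem randAlg_pr_nonneg {α β : Type} (B : RandAlg α β) (ea : α → List Bool) (x : α) (E : Set β) :
    0 ≤ B.pr ea x E := ENNReal.toReal_nonneg

/-- Event bound for `selectEnc`: if the INTENDED constant misses `E`, landing in `E` needs a wrong verdict. -/
theorem selectEnc_pr_le_of_not_mem (A : RandAlg (List Bool) Bool) (w₀ w₁ : List Bool) (x : List Bool)
    (b₀ : Bool) {E : Set (List Bool)} (hE : (if b₀ then w₁ else w₀) ∉ E) :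
    (selectEnc A w₀ w₁).pr id x E ≤ A.pr id x {b | b ≠ b₀} := by
  unfold RandAlg.pr
  rw [selectEnc_outputPMF, PMF.toOuterMeasure_map_apply]
  have hfin : (A.outputPMF id x).toOuterMeasure {b | b ≠ b₀} ≠ ⊤ :=
    ne_of_lt (lt_of_le_of_lt ((PMF.toOuterMeasure_mono _ (Set.subset_univ _)).trans_eq
      ((PMF.toOuterMeasure_apply_eq_one_iff _ _).2 (Set.subset_univ _))) ENNReal.one_lt_top)
  refine ENNReal.toReal_mono hfin (PMF.toOuterMeasure_mono _ fun b hb => ?_)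
  intro hbb
  apply hE
  have : b = b₀ := by simpa using hbb
  subst this
  exact hb.1

/-- The constant sampler on a fixed string, as a `RandAlg ℕ (List Bool)` (coin-free). -/
def constSamp (w : List Bool) : RandAlg ℕ (List Bool) := RandAlg.ofDet fun _ => w

theorem constSamp_isPolyTime (w : List Bool) :
    (constSamp w).IsPolyTime unaryEncodeNat (id : List Bool → List Bool) := by
  have hc : PolyTimeComputable unaryEncodeNat (id : List Bool → List Bool) (fun _ : ℕ => w) :=
    PolyTimeComputable.of_encode_eq (f := fun _ : List Bool => w) unaryEncodeNat
      (fun _ => rfl) (fun _ => rfl) (const_mem_FP w)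
  exact RandAlg.IsPolyTime.ofDet_holds hc

theorem constSamp_support (w : List Bool) (n : ℕ) (v : List Bool)
    (hv : v ∈ ((constSamp w).outputPMF unaryEncodeNat n).support) : v = w := by
  unfold constSamp at hv
  rw [RandAlg.outputPMF_ofDet] at hv
  simpa using hv

theorem constSamp_pr_of_mem (w : List Bool) (n : ℕ) {E : Set (List Bool)} (hE : w ∈ E) :
    (constSamp w).pr unaryEncodeNat n E = 1 := by
  classical
  unfold constSamp
  rw [RandAlg.pr_ofDet, if_pos hE]

/-- **CALIBRATION OF STUB 1.** The kill switch `PEA 3 ∈ PromiseBPP'` yields a mode kit: constant certified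
samplers on the fixed NO / YES instances of `BPEA` (`exists_mem_BPEA_no/yes`) and the encoder `selectEnc A w₀ w₁`
for the amplified promise decider `A` of `exists_randAlg_promise_error_le` (error `≤ 1/16` on the promise).
Hence `Nonempty ModeKit` cannot be refuted without proving `PEA 3 ∉ PromiseBPP'`. [AroraBarak2009, Thm. 7.10;
Goldreich2006, Def. 1.2; ApplebaumRaykov2016, §1 (trivial encodings of easy problems)] -/
theorem modeKit_of_mem_PromiseBPP' (h : PEA 3 ∈ PromiseBPP') : Nonempty ModeKit := by
  classical
  obtain ⟨A, hA, ⟨q, hq⟩, -, herr⟩ :=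
    exists_randAlg_promise_error_le (PEA_disjoint 3) h (by norm_num : (0 : ℝ) < 1 / 16)
  let w₀ : List Bool := BPEAInst.encoding.encode ⟨0, ([], 0)⟩
  let w₁ : List Bool := BPEAInst.encoding.encode ⟨1, ([[[((false, [0]) : AffLabel 1)]]], 0)⟩
  have hw₀ : w₀ ∈ BPEA.no := exists_mem_BPEA_no
  have hw₁ : w₁ ∈ BPEA.yes := exists_mem_BPEA_yes
  refine ⟨{ samp := fun b => constSamp (if b then w₁ else w₀)
            samp_polyTime := fun b => constSamp_isPolyTime _
            sampCoins := 0
            samp_coinLen := fun b ℓ => by simp [constSamp, RandAlg.ofDet]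
            samp_no := fun n v hv => ?_
            samp_yes := fun n v hv => ?_
            enc := selectEnc A w₀ w₁
            enc_polyTime := selectEnc_isPolyTime hA w₀ w₁
            encCoins := q
            enc_coinLen := hq
            enc_yes := fun x hx E => ?_
            enc_no := fun x hx E => ?_ }⟩
  · rw [constSamp_support _ n v hv]
    exact hw₀
  · rw [constSamp_support _ n v hv]
    exact hw₁
  · -- YES instance: the intended constant is `w₁`
    by_cases hE : w₁ ∈ E
    · have h1 := randAlg_pr_le_one (selectEnc A w₀ w₁) id x E
      have h2 : (constSamp (if true then w₁ else w₀)).pr unaryEncodeNat x.length E = 1 :=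
        constSamp_pr_of_mem _ _ (by simpa using hE)
      rw [h2]
      linarith
    · have hind : (PEA 3).yes.boolIndicator x = true := (Set.mem_iff_boolIndicator _ _).1 hx
      have h1 := selectEnc_pr_le_of_not_mem A w₀ w₁ x true (E := E) (by simpa using hE)
      have h2 := herr x (Or.inl hx)
      rw [hind] at h2
      have h12 : (selectEnc A w₀ w₁).pr id x E ≤ 1 / 16 := h1.trans h2
      have key : ∀ t : ℝ, 0 ≤ t → (selectEnc A w₀ w₁).pr id x E ≤ t + 1 / 16 := fun t ht => by linarith
      exact key _ (randAlg_pr_nonneg _ _ _ _)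
  · -- NO instance: the intended constant is `w₀`
    by_cases hE : w₀ ∈ E
    · have h1 := randAlg_pr_le_one (selectEnc A w₀ w₁) id x E
      have h2 : (constSamp (if false then w₁ else w₀)).pr unaryEncodeNat x.length E = 1 :=
        constSamp_pr_of_mem _ _ (by simpa using hE)
      rw [h2]
      linarith
    · have hx' : x ∉ (PEA 3).yes := fun h' => Set.disjoint_left.1 (PEA_disjoint 3) h' hx
      have hind : (PEA 3).yes.boolIndicator x = false := (Set.notMem_iff_boolIndicator _ _).1 hx'
      have h1 := selectEnc_pr_le_of_not_mem A w₀ w₁ x false (E := E) (by simpa using hE)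
      have h2 := herr x (Or.inr hx)
      rw [hind] at h2
      have h12 : (selectEnc A w₀ w₁).pr id x E ≤ 1 / 16 := h1.trans h2
      have key : ∀ t : ℝ, 0 ≤ t → (selectEnc A w₀ w₁).pr id x E ≤ t + 1 / 16 := fun t ht => by linarith
      exact key _ (randAlg_pr_nonneg _ _ _ _)

/-- Refuting STUB 1 proves the crux's hypothesis `A`. -/
theorem not_modeEncodingStmt_imp_hyp (h : ¬ ModeEncodingStmt) : PEA 3 ∉ PromiseBPP' :=
  fun hB => h (modeKit_of_mem_PromiseBPP' hB)

/-- Refuting STUB 1 proves the route's THESIS X (`PeaThreeNotInP`, i.e. `PEA 3 ∉ PromiseP`). -/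
theorem not_modeEncodingStmt_imp_peaThreeNotInP (h : ¬ ModeEncodingStmt) :
    Summit.PneNP.PneNP.Theses.SzkEntropy.PeaThreeNotInP :=
  szkEntropy_peaThreeNotInP_of_not_peaThreeMemBPP fun hK =>
    not_modeEncodingStmt_imp_hyp h (szkEntropy_peaThreeMemBPP_iff.1 hK)

/-- Refuting STUB 4 exhibits a mode kit AND proves the crux's hypothesis (hence thesis X as above). -/
theorem not_deciderStmt_imp (h : ¬ DeciderStmt) : Nonempty ModeKit ∧ PEA 3 ∉ PromiseBPP' := by
  unfold DeciderStmt at h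
  push Not at h
  obtain ⟨kit, -, hB⟩ := h
  exact ⟨⟨kit⟩, hB⟩

end Summit.PneNP.PneNP.Cruxes.PeaWorstToAvg.Drefute

end
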